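import Literature.NumberTheory.Automorphic.ModularEisensteinContinuation
import HarnessLib

/-!
# The Eisenstein series of the cusp `∞` of `Γ₀(N)`, I: the level-one residue and the Hecke-type
# identity `Σ_{u ∣ t} J_s(u) G_u(z, s) = tˢ G₁(tz, s)`

Topic `Literature/NumberTheory/EllipticCurves`; theorems only (no definition, no named fact). Fourth
brick of the printed proof behind the named fact `murty_petersson_newform_lower_bound`
(`NewformPeterssonSize.lean`; Murty 1999, §2: Rankin–Selberg unfolding, then Hoffstein–Lockhart),
after `NewformPeterssonSizeProofs`, `Gamma0RankinSelbergUnfolding`, `RankinSelbergStripIntegral`: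
here and in the sequel `Gamma0EisensteinResidue.lean` we compute the residue at `s = 1` of the
weight of the unfolding, the Eisenstein series of the cusp `∞` of `Γ₀(N)`,

  `G_N(z, s) := Σ_{(c,d)=1, N ∣ c} (y/|cz + d|²)ˢ = 2 E_∞^{Γ₀(N)}(z, s)`   (`s > 1` real),

from the tree's level-one theory (`Literature.NumberTheory.Automorphic.ModularEisensteinSeries`,
`…Continuation`: `E(z, s) = eisensteinE`, its completion `E*` with the pole structure
`completedEisenstein_eq` and `E* = π^{-s}Γ(s)ζ(2s) E` for `Re s > 1`). All index types are written
out (`{v : Fin 2 → ℤ // IsCoprime (v 0) (v 1) ∧ (t : ℤ) ∣ v 0}`), no definition is introduced.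

## Contents

1. `tendsto_sub_one_mul_eisensteinE`, `tendsto_sub_one_mul_tsum_coprime`: **the level-one
   residue** `(s − 1) E(z, s) → 3/π` (`s → 1`, `Re s > 1`) and, for real `s → 1⁺`,
   `(s − 1) G₁(z, s) → 6/π` (Iwaniec (3.26): `res_{s=1} E(z, s) = 1/|F| = 3/π`).
2. `bijective_smul_coprime`: `(g, w) ↦ g w`, `ℕ⁺ × {coprime pairs} ≃ {pairs ≠ 0}` (sorting by the
   gcd); `tsum_pnat_ite_dvd_rpow`: `Σ_{g ≥ 1, t ∣ g c} g^{-2s} = (gcd(t,|c|)/t)^{2s} ζ⁺(2s)`,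
   `ζ⁺(2s) = Σ_{m ≥ 1} m^{-2s}`.
3. `tsum_ite_dvd_eq_tsum_coprime` (`ℝ≥0∞`) / `…_real`: **gcd sorting with a divisibility
   constraint**: `S_t(z, s) := Σ'_{p ≠ 0, t ∣ p₀} (y/|p₀z + p₁|²)ˢ = ζ⁺(2s) Σ_{w coprime}
   (y/|w₀z+w₁|²)ˢ (gcd(t, |w₀|)/t)^{2s}` (Tonelli in `ℝ≥0∞`, then finiteness for `s > 1`).
4. `tsum_coprime_gcd_rpow_eq_sum_divisors`: **Möbius**, `gcd(t,|c|)^{2s} = Σ_{u ∣ t, u ∣ c} J_s(u)`,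
   `J_s(u) = Σ_{de = u} μ(d) e^{2s}` (Mathlib `ArithmeticFunction.sum_eq_iff_sum_smul_moebius_eq`),
   whence `S_t(z, s) = ζ⁺(2s) t^{-2s} Σ_{u ∣ t} J_s(u) G_u(z, s)`.
5. `tsum_ite_dvd_eq_rpow_mul_tsum_scaled`: the substitution `p₀ = t m`: `S_t(z, s) = t^{-s} S₁(tz, s)`
   (`tz` through Mathlib's `posRealAction` on `ℍ`).
6. `sum_divisors_moebius_mul_tsum_coprime_eq`: **the Hecke-type identity**
   `Σ_{u ∣ t} J_s(u) G_u(z, s) = tˢ G₁(tz, s)` (3.–5. combined, `ζ⁺(2s) > 0` cancelled) — the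
   classical expression of `E_∞^{Γ₀(N)}` through `E(dz, s)`, `d ∣ N`, in the form needed for an
   induction over the divisors (the sequel).

## References

* [Iwaniec2002] H. Iwaniec, *Spectral Methods of Automorphic Forms*, GSM 53: §3.2 (3.10)–(3.11)
  (Eisenstein series of a cusp), (3.26) (the residue at `s = 1`), §2.3–2.4 (cusps of `Γ₀(N)`).
* [DiamondShurman2005] F. Diamond, J. Shurman, GTM 228, §4.2, §4.10 (Eisenstein series of level `N`
  from level one by Möbius inversion over the divisors).
* [Murty1999CongruencePrimes] M. R. Murty, *Bounds for congruence primes* (1999), §2.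
-/

noncomputable section

open scoped MatrixGroups ModularForm Real Topology ENNReal NNReal
open UpperHalfPlane hiding I
open MeasureTheory Set Filter Complex EisensteinSeries ArithmeticFunction
open scoped ArithmeticFunction.Moebius
open Literature.NumberTheory.Automorphic

namespace Literature.NumberTheory.EllipticCurves.ModularForms



/-! ### Level one: `res_{s=1} E(z, s) = 3/π` -/

section LevelOne

/-- `θ(s) = π^{-s} Γ(s) ζ(2s) → θ(1) = π⁻¹ · 1 · π²/6 = π/6` as `s → 1` (Mathlib `riemannZeta_two`,
`Complex.Gamma_one`). [folklore] -/
theorem tendsto_eisensteinTheta_one :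
    Tendsto (fun s : ℂ ↦ (π : ℂ) ^ (-s) * Complex.Gamma s * riemannZeta (2 * s)) (𝓝 1)
      (𝓝 ((π : ℂ) / 6)) := by
  have h1 : ContinuousAt (fun s : ℂ ↦ (π : ℂ) ^ (-s)) 1 := by
    refine ContinuousAt.const_cpow continuous_neg.continuousAt (Or.inl ?_)
    exact_mod_cast Real.pi_ne_zero
  have h2 : ContinuousAt Complex.Gamma 1 :=
    (Complex.differentiableAt_Gamma _ (fun m h ↦ by
      have hm := congrArg Complex.re h
      have h0 : (0 : ℝ) ≤ m := Nat.cast_nonneg m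
      simp at hm
      linarith)).continuousAt
  have h3 : ContinuousAt (fun s : ℂ ↦ riemannZeta (2 * s)) 1 := by
    refine ContinuousAt.comp (g := riemannZeta) ?_ (continuous_const.mul continuous_id).continuousAt
    exact (differentiableAt_riemannZeta (by norm_num)).continuousAt
  have h := (h1.mul h2).mul h3
  have hv : (π : ℂ) ^ (-(1 : ℂ)) * Complex.Gamma 1 * riemannZeta (2 * 1) = (π : ℂ) / 6 := by
    rw [mul_one, riemannZeta_two, Complex.Gamma_one, mul_one, Complex.cpow_neg_one]
    have : (π : ℂ) ≠ 0 := by exact_mod_cast Real.pi_ne_zero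
    field_simp
  rw [← hv]
  exact h.tendsto

/-- `(s − 1) E*(z, s) → 1/2` as `s → 1` (`s ≠ 1`): the simple pole of the completed Eisenstein
series (the tree's `completedEisenstein_eq`: `E* = E*₀ − 1/(2s) − 1/(2(1−s))` with `E*₀` entire;
Iwaniec (3.26)). [cite: Iwaniec2002, (3.26) (residue of E(z,s) at s = 1), PDF p. 47] -/
theorem tendsto_sub_one_mul_completedEisenstein (z : ℍ) :
    Tendsto (fun s : ℂ ↦ (s - 1) * completedEisenstein z s) (𝓝[≠] 1) (𝓝 (1 / 2)) := by
  have heq : ∀ s : ℂ, s ≠ 1 → s ≠ 0 → (s - 1) * completedEisenstein z s =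
      (s - 1) * completedEisenstein₀ z s - (s - 1) / (2 * s) + 1 / 2 := by
    intro s hs1 hs0
    rw [completedEisenstein_eq]
    have h1s : (1 - s) ≠ 0 := sub_ne_zero.mpr (Ne.symm hs1)
    field_simp
    ring
  have hcont : ContinuousAt (fun s : ℂ ↦ (s - 1) * completedEisenstein₀ z s - (s - 1) / (2 * s) + 1 / 2) 1 := by
    refine ((continuousAt_id.sub continuousAt_const).mul
      (differentiable_completedEisenstein₀ z 1).continuousAt).sub ?_ |>.add continuousAt_const
    exact (continuousAt_id.sub continuousAt_const).div (continuousAt_const.mul continuousAt_id)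
      (by norm_num)
  have hlim : Tendsto (fun s : ℂ ↦ (s - 1) * completedEisenstein₀ z s - (s - 1) / (2 * s) + 1 / 2)
      (𝓝[≠] 1) (𝓝 (1 / 2)) := by
    have := hcont.tendsto
    simp only [sub_self, zero_mul, zero_div, zero_add] at this
    exact this.mono_left nhdsWithin_le_nhds
  refine hlim.congr' ?_
  have hne0 : ∀ᶠ s : ℂ in 𝓝[≠] 1, s ≠ 0 :=
    (continuous_id.continuousAt.eventually_ne (by norm_num : (1 : ℂ) ≠ 0)).filter_mono
      nhdsWithin_le_nhds
  filter_upwards [hne0, self_mem_nhdsWithin] with s hs0 hs1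
  exact (heq s hs1 hs0).symm

/-- **`res_{s=1} E(z, s) = 3/π`**, in the form `(s − 1) E(z, s) → 3/π` as `s → 1` through
`Re s > 1` (where `E = E*/θ`, `completedEisenstein_eq_theta_mul`; `(1/2)/(π/6) = 3/π = 1/|F|`).
[cite: Iwaniec2002, (3.26), PDF p. 47] -/
theorem tendsto_sub_one_mul_eisensteinE (z : ℍ) :
    Tendsto (fun s : ℂ ↦ (s - 1) * eisensteinE z s) (𝓝[{s : ℂ | 1 < s.re}] 1) (𝓝 (3 / π)) := by
  have hsub : {s : ℂ | 1 < s.re} ⊆ {(1 : ℂ)}ᶜ := by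
    intro s hs h1
    rw [mem_singleton_iff] at h1
    simp only [mem_setOf_eq] at hs
    rw [h1, Complex.one_re] at hs
    exact lt_irrefl _ hs
  have hθ := (tendsto_eisensteinTheta_one.mono_left (nhdsWithin_le_nhds (s := {s : ℂ | 1 < s.re})))
  have hE := (tendsto_sub_one_mul_completedEisenstein z).mono_left (nhdsWithin_mono _ hsub)
  have hπ6 : (π : ℂ) / 6 ≠ 0 := by
    have : (π : ℂ) ≠ 0 := by exact_mod_cast Real.pi_ne_zero
    exact div_ne_zero this (by norm_num)
  have hdiv := hE.div hθ hπ6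
  have hval : (1 / 2 : ℂ) / ((π : ℂ) / 6) = 3 / π := by
    have : (π : ℂ) ≠ 0 := by exact_mod_cast Real.pi_ne_zero
    field_simp
    norm_num
  rw [hval] at hdiv
  refine hdiv.congr' ?_
  filter_upwards [self_mem_nhdsWithin] with s hs
  have hθne : (π : ℂ) ^ (-s) * Complex.Gamma s * riemannZeta (2 * s) ≠ 0 := by
    refine mul_ne_zero (mul_ne_zero ?_ ?_) ?_
    · exact Complex.cpow_ne_zero_iff_of_exponent_ne_zero (by
        intro h; rw [neg_eq_zero] at h; rw [h, Complex.zero_re] at hs; linarith) |>.mpr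
        (by exact_mod_cast Real.pi_ne_zero)
    · exact Complex.Gamma_ne_zero_of_re_pos (by linarith)
    · exact riemannZeta_ne_zero_of_one_lt_re (by simp; linarith)
  simp only [Pi.div_apply]
  rw [completedEisenstein_eq_theta_mul z hs, mul_comm _ (eisensteinE z s), ← mul_assoc,
    mul_div_assoc, div_self hθne, mul_one]

/-- For real `s`, `Σ_{(c,d)=1} (y/|cz+d|²)ˢ` (a real `tsum` over the coprime pairs, written with
the trivially true constraint `1 ∣ c` for uniformity with level `N`) is `2 E(z, s)`
(`eisensteinE` carries the factor `½` for `±(c,d)`; Iwaniec (3.11)). [folklore] -/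
theorem ofReal_tsum_coprime_eq_two_mul_eisensteinE (z : ℍ) (s : ℝ) :
    ((∑' v : {v : Fin 2 → ℤ // IsCoprime (v 0) (v 1) ∧ ((1 : ℕ) : ℤ) ∣ v 0},
        (z.im / Complex.normSq ((v.1 0 : ℂ) * z + v.1 1)) ^ s : ℝ) : ℂ) =
      2 * eisensteinE z s := by
  unfold eisensteinE
  rw [← mul_assoc, show (2 : ℂ) * (1 / 2) = 1 by norm_num, one_mul, Complex.ofReal_tsum]
  let e : {v : Fin 2 → ℤ // IsCoprime (v 0) (v 1) ∧ ((1 : ℕ) : ℤ) ∣ v 0} ≃ gammaSet 1 1 0 :=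
    { toFun := fun v ↦ ⟨v.1, (mem_gammaSet_one v.1).mpr v.2.1⟩
      invFun := fun w ↦ ⟨w.1, (mem_gammaSet_one w.1).mp w.2, by simp⟩
      left_inv := fun v ↦ rfl
      right_inv := fun w ↦ rfl }
  rw [← e.tsum_eq]
  refine tsum_congr fun v ↦ ?_
  simp only [e, Equiv.coe_fn_mk, esTerm]
  rw [Complex.normSq_eq_norm_sq, Complex.ofReal_cpow (by positivity)]

/-- **Level one, real form: `(s − 1) G₁(z, s) → 6/π` as `s → 1⁺`**, `G₁(z, s) = Σ_{(c,d)=1}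
(y/|cz+d|²)ˢ = 2E(z, s)`. [cite: Iwaniec2002, (3.26), PDF p. 47] -/
theorem tendsto_sub_one_mul_tsum_coprime (z : ℍ) :
    Tendsto (fun s : ℝ ↦ (s - 1) *
        ∑' v : {v : Fin 2 → ℤ // IsCoprime (v 0) (v 1) ∧ ((1 : ℕ) : ℤ) ∣ v 0},
          (z.im / Complex.normSq ((v.1 0 : ℂ) * z + v.1 1)) ^ s)
      (𝓝[>] 1) (𝓝 (6 / π)) := by
  have hmap : Tendsto (fun s : ℝ ↦ (s : ℂ)) (𝓝[>] 1) (𝓝[{s : ℂ | 1 < s.re}] 1) := by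
    have h := (Complex.continuous_ofReal.continuousWithinAt (s := Ioi (1 : ℝ)) (x := 1)).tendsto_nhdsWithin
      (t := {s : ℂ | 1 < s.re}) (fun s hs ↦ by simpa using hs)
    simpa using h
  have h := ((tendsto_sub_one_mul_eisensteinE z).comp hmap).const_mul (2 : ℂ)
  have h3 : Tendsto (fun s : ℝ ↦ (((s - 1) *
      ∑' v : {v : Fin 2 → ℤ // IsCoprime (v 0) (v 1) ∧ ((1 : ℕ) : ℤ) ∣ v 0},
        (z.im / Complex.normSq ((v.1 0 : ℂ) * z + v.1 1)) ^ s : ℝ) : ℂ)) (𝓝[>] 1) (𝓝 (2 * (3 / π))) := by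
    refine h.congr' ?_
    filter_upwards [self_mem_nhdsWithin] with s hs
    simp only [Function.comp_apply]
    rw [Complex.ofReal_mul, Complex.ofReal_sub, Complex.ofReal_one,
      ofReal_tsum_coprime_eq_two_mul_eisensteinE z s]
    ring
  have h4 := (Complex.continuous_re.tendsto _).comp h3
  have hre : ((2 : ℂ) * (3 / π)).re = 6 / π := by
    rw [show (2 : ℂ) * (3 / π) = ((6 / π : ℝ) : ℂ) by push_cast; ring, Complex.ofReal_re]
  rw [hre] at h4
  refine h4.congr fun s ↦ ?_
  simp only [Function.comp_apply, Complex.ofReal_re]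

end LevelOne


/-! ### Sorting pairs by the gcd -/

section PairsAlgebra

/-- `y/|(gc)z + gd|² = (y/|cz+d|²)/g²`. [folklore] -/
theorem im_div_normSq_smul (z : ℍ) (g : ℤ) (v : Fin 2 → ℤ) :
    z.im / Complex.normSq (((g • v) 0 : ℤ) * (z : ℂ) + ((g • v) 1 : ℤ)) =
      z.im / Complex.normSq ((v 0 : ℂ) * z + v 1) / (g : ℝ) ^ 2 := by
  simp only [Pi.smul_apply, smul_eq_mul, Int.cast_mul]
  rw [show ((g : ℂ) * (v 0 : ℂ)) * (z : ℂ) + (g : ℂ) * (v 1 : ℂ) = (g : ℂ) * ((v 0 : ℂ) * z + v 1) by ring,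
    Complex.normSq_mul, Complex.normSq_intCast]
  rw [div_div, mul_comm, sq]

/-- `gcd(gc, gd) = g` for a coprime pair `(c, d)` and `g ∈ ℕ`. [folklore] -/
theorem int_gcd_smul_of_isCoprime {w : Fin 2 → ℤ} (hw : IsCoprime (w 0) (w 1)) (g : ℕ) :
    Int.gcd (((g : ℤ) • w) 0) (((g : ℤ) • w) 1) = g := by
  simp only [Pi.smul_apply, smul_eq_mul]
  rw [Int.gcd_mul_left, Int.isCoprime_iff_gcd_eq_one.mp hw, mul_one, Int.natAbs_natCast]

/-- **Sorting integer pairs by their gcd**: `(g, w) ↦ g w` is a bijection from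
`ℕ⁺ × {(c, d) = 1}` onto the non-zero pairs (inverse: `p ↦ (gcd p, p/gcd p)`; the indexation behind
`Σ_{(m,n)≠0} = ζ(2s) Σ_{(c,d)=1}`, Iwaniec (3.11); cf. Mathlib `gammaSetDivGcdSigmaEquiv`). [folklore] -/
theorem bijective_smul_coprime :
    Function.Bijective (fun x : ℕ+ × {w : Fin 2 → ℤ // IsCoprime (w 0) (w 1)} ↦
      (⟨((x.1 : ℕ) : ℤ) • x.2.1, by
        intro h
        have h0 : (((x.1 : ℕ) : ℤ) • x.2.1) 0 = 0 := by rw [h]; rfl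
        have h1 : (((x.1 : ℕ) : ℤ) • x.2.1) 1 = 0 := by rw [h]; rfl
        have hg := int_gcd_smul_of_isCoprime x.2.2 (x.1 : ℕ)
        rw [h0, h1, Int.gcd_zero_left, Int.natAbs_zero] at hg
        exact x.1.ne_zero hg.symm⟩ : {p : Fin 2 → ℤ // p ≠ 0})) := by
  constructor
  · rintro ⟨g, w⟩ ⟨g', w'⟩ h
    simp only [Subtype.mk.injEq] at h
    have hg : (g : ℕ) = g' := by
      have := int_gcd_smul_of_isCoprime w.2 g
      rw [h, int_gcd_smul_of_isCoprime w'.2 g'] at this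
      exact this.symm
    have hgg : g = g' := PNat.coe_injective hg
    subst hgg
    have hw : w.1 = w'.1 := by
      have hne : ((g : ℕ) : ℤ) ≠ 0 := by exact_mod_cast g.ne_zero
      funext i
      have := congrFun h i
      simp only [Pi.smul_apply, smul_eq_mul] at this
      exact mul_left_cancel₀ hne this
    rw [Prod.mk.injEq]
    exact ⟨rfl, Subtype.ext hw⟩
  · rintro ⟨p, hp⟩
    set g : ℕ := Int.gcd (p 0) (p 1) with hgdef
    have hgpos : 0 < g := by
      rw [hgdef, Int.gcd_pos_iff]
      by_contra h
      push Not at h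
      apply hp
      funext i
      fin_cases i
      · exact h.1
      · exact h.2
    have hd0 : (g : ℤ) ∣ p 0 := Int.gcd_dvd_left _ _
    have hd1 : (g : ℤ) ∣ p 1 := Int.gcd_dvd_right _ _
    set w : Fin 2 → ℤ := ![p 0 / g, p 1 / g] with hwdef
    have hw : IsCoprime (w 0) (w 1) := by
      rw [Int.isCoprime_iff_gcd_eq_one]
      simp only [hwdef, Matrix.cons_val_zero, Matrix.cons_val_one, Matrix.cons_val_fin_one]
      exact Int.gcd_div_gcd_div_gcd hgpos
    refine ⟨(⟨g, hgpos⟩, ⟨w, hw⟩), ?_⟩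
    simp only [Subtype.mk.injEq, PNat.mk_coe]
    funext i
    fin_cases i
    · simp only [Pi.smul_apply, smul_eq_mul, hwdef, Fin.zero_eta, Matrix.cons_val_zero]
      exact Int.mul_ediv_cancel' hd0
    · simp only [Pi.smul_apply, smul_eq_mul, hwdef, Fin.mk_one, Matrix.cons_val_one,
        Matrix.cons_val_fin_one]
      exact Int.mul_ediv_cancel' hd1

/-- `t ∣ g·a ↔ t/gcd(t, |a|) ∣ g` (`t ≥ 1`, `g ∈ ℕ`, `a ∈ ℤ`). [folklore] -/
theorem natCast_dvd_mul_iff {t : ℕ} (ht : 0 < t) (g : ℕ) (a : ℤ) :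
    (t : ℤ) ∣ (g : ℤ) * a ↔ t / Nat.gcd t a.natAbs ∣ g := by
  set d : ℕ := Nat.gcd t a.natAbs with hd
  have hdpos : 0 < d := Nat.gcd_pos_of_pos_left _ ht
  have hdt : d ∣ t := Nat.gcd_dvd_left _ _
  have hda : d ∣ a.natAbs := Nat.gcd_dvd_right _ _
  obtain ⟨t', ht'⟩ := hdt
  obtain ⟨a', ha'⟩ := hda
  have hcop : Nat.Coprime t' a' := by
    have h := Nat.coprime_div_gcd_div_gcd (m := t) (n := a.natAbs) hdpos
    rw [← hd] at h
    have e1 : t / d = t' := by rw [ht', Nat.mul_div_cancel_left _ hdpos]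
    have e2 : a.natAbs / d = a' := by rw [ha', Nat.mul_div_cancel_left _ hdpos]
    rwa [e1, e2] at h
  have e1 : t / d = t' := by rw [ht', Nat.mul_div_cancel_left _ hdpos]
  rw [e1]
  have key : ((t : ℤ) ∣ (g : ℤ) * a) ↔ (t ∣ g * a.natAbs) := by
    rw [← Int.natAbs_dvd_natAbs, Int.natAbs_mul, Int.natAbs_natCast, Int.natAbs_natCast]
  rw [key, ht', ha']
  constructor
  · intro h
    have h2 : t' ∣ g * a' := by
      have : d * t' ∣ d * (g * a') := by
        rw [show d * (g * a') = g * (d * a') by ring]; exact h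
      exact (Nat.mul_dvd_mul_iff_left hdpos).mp this
    exact hcop.dvd_of_dvd_mul_right h2
  · intro h
    calc d * t' ∣ d * g := Nat.mul_dvd_mul_left d h
      _ ∣ g * (d * a') := ⟨a', by ring⟩

/-- `Σ_{m ≥ 1} m^{-2s}` converges for `2s > 1`. [folklore] -/
theorem summable_pnat_rpow_neg {s : ℝ} (hs : 1 < 2 * s) :
    Summable fun m : ℕ+ ↦ ((m : ℕ) : ℝ) ^ (-(2 * s)) :=
  (Real.summable_nat_rpow.mpr (by linarith : -(2 * s) < -1)).comp_injective PNat.coe_injective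

/-- **The sum over the multiples**: `Σ_{g ≥ 1, t ∣ g a} g^{-2s} = (gcd(t,|a|)/t)^{2s} Σ_{m≥1} m^{-2s}`
(the `g` with `t ∣ ga` are the multiples of `t' = t/gcd(t,|a|)`), in `ℝ≥0∞`. [folklore] -/
theorem tsum_pnat_ite_dvd_rpow {t : ℕ} (ht : 0 < t) (a : ℤ) {s : ℝ} (hs : 1 < 2 * s) :
    ∑' g : ℕ+, (if (t : ℤ) ∣ ((g : ℕ) : ℤ) * a then ENNReal.ofReal (((g : ℕ) : ℝ) ^ (-(2 * s))) else 0) =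
      ENNReal.ofReal ((((Nat.gcd t a.natAbs : ℕ) : ℝ) / t) ^ (2 * s) *
        ∑' m : ℕ+, ((m : ℕ) : ℝ) ^ (-(2 * s))) := by
  set d : ℕ := Nat.gcd t a.natAbs with hd
  have hdpos : 0 < d := Nat.gcd_pos_of_pos_left _ ht
  have hdt : d ∣ t := Nat.gcd_dvd_left _ _
  set t' : ℕ := t / d with ht'
  have htt : t = d * t' := (Nat.mul_div_cancel' hdt).symm
  have ht'pos : 0 < t' := Nat.div_pos (Nat.le_of_dvd ht hdt) hdpos
  have hcond : ∀ g : ℕ+, ((t : ℤ) ∣ ((g : ℕ) : ℤ) * a) ↔ t' ∣ (g : ℕ) := fun g ↦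
    natCast_dvd_mul_iff ht g a
  simp only [hcond]
  -- reindex by `m ↦ t' m`
  let ι : ℕ+ → ℕ+ := fun m ↦ ⟨t' * m, Nat.mul_pos ht'pos m.pos⟩
  have hι : Function.Injective ι := by
    intro m m' h
    have h2 : t' * (m : ℕ) = t' * m' := congrArg PNat.val h
    exact PNat.coe_injective (Nat.eq_of_mul_eq_mul_left ht'pos h2)
  have hsupp : Function.support (fun g : ℕ+ ↦
      if t' ∣ (g : ℕ) then ENNReal.ofReal (((g : ℕ) : ℝ) ^ (-(2 * s))) else 0) ⊆ Set.range ι := by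
    intro g hg
    rw [Function.mem_support] at hg
    have hdvd : t' ∣ (g : ℕ) := by
      by_contra h
      exact hg (if_neg h)
    obtain ⟨m, hm⟩ := hdvd
    have hmpos : 0 < m := Nat.pos_of_ne_zero fun h0 ↦ by
      rw [h0, mul_zero] at hm
      exact g.ne_zero hm
    exact ⟨⟨m, hmpos⟩, PNat.coe_injective (by simp [ι, hm])⟩
  rw [← hι.tsum_eq hsupp]
  simp only [ι, PNat.mk_coe, dvd_mul_right, if_true]
  have hsplit : ∀ m : ℕ+, ENNReal.ofReal (((t' * (m : ℕ) : ℕ) : ℝ) ^ (-(2 * s))) =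
      ENNReal.ofReal ((t' : ℝ) ^ (-(2 * s))) * ENNReal.ofReal (((m : ℕ) : ℝ) ^ (-(2 * s))) := by
    intro m
    rw [Nat.cast_mul, Real.mul_rpow (by positivity) (by positivity),
      ENNReal.ofReal_mul (Real.rpow_nonneg (by positivity) _)]
  simp_rw [hsplit]
  rw [ENNReal.tsum_mul_left, ← ENNReal.ofReal_tsum_of_nonneg (fun m ↦ Real.rpow_nonneg (by positivity) _)
    (summable_pnat_rpow_neg hs), ← ENNReal.ofReal_mul (Real.rpow_nonneg (by positivity) _)]
  congr 2
  -- `t'^{-2s} = (d/t)^{2s}`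
  have ht'cast : (t' : ℝ) = (t : ℝ) / d := by
    rw [htt, Nat.cast_mul, mul_div_cancel_left₀ _ (by exact_mod_cast hdpos.ne')]
  rw [ht'cast, Real.rpow_neg (by positivity), ← Real.inv_rpow (by positivity), inv_div]

end PairsAlgebra

/-! ### `Σ_{p ≠ 0, t ∣ p₀}` by gcd sorting and Möbius inversion -/

section GcdSorting

/-- **Sorting the pairs `p ≠ 0` with `t ∣ p₀` by their gcd** (in `ℝ≥0∞`, no convergence needed):
`Σ_{p ≠ 0, t ∣ p₀} (y/|p₀z+p₁|²)ˢ = ζ⁺(2s) · Σ_{w coprime} (y/|w₀z+w₁|²)ˢ (gcd(t,|w₀|)/t)^{2s}`,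
`ζ⁺(2s) = Σ_{m≥1} m^{-2s}` — write `p = g w`, `(y/|gw₀z + gw₁|²)ˢ = g^{-2s}(y/|w₀z+w₁|²)ˢ`, swap the
sums (Tonelli) and use `tsum_pnat_ite_dvd_rpow`. At `t = 1` this is Iwaniec's
`Σ_{(m,n)≠0} = ζ(2s)Σ_{(c,d)=1}` ((3.11); the tree's `tsum_esTerm_eq_zeta_mul`). [cite: Iwaniec2002, §3.2 (3.11), PDF p. 43] -/
theorem tsum_ite_dvd_eq_tsum_coprime (z : ℍ) {s : ℝ} (hs : 1 / 2 < s) {t : ℕ} (ht : 0 < t) :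
    ∑' p : Fin 2 → ℤ, (if p ≠ 0 ∧ (t : ℤ) ∣ p 0 then
        ENNReal.ofReal ((z.im / Complex.normSq ((p 0 : ℂ) * z + p 1)) ^ s) else 0) =
      ENNReal.ofReal (∑' m : ℕ+, ((m : ℕ) : ℝ) ^ (-(2 * s))) *
        ∑' w : {w : Fin 2 → ℤ // IsCoprime (w 0) (w 1)},
          ENNReal.ofReal ((z.im / Complex.normSq ((w.1 0 : ℂ) * z + w.1 1)) ^ s *
            (((Nat.gcd t (w.1 0).natAbs : ℕ) : ℝ) / t) ^ (2 * s)) := by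
  set A : (Fin 2 → ℤ) → ℝ≥0∞ := fun p ↦ if p ≠ 0 ∧ (t : ℤ) ∣ p 0 then
    ENNReal.ofReal ((z.im / Complex.normSq ((p 0 : ℂ) * z + p 1)) ^ s) else 0 with hA
  -- α : drop `p = 0`
  have hα : ∑' p, A p = ∑' p : {p : Fin 2 → ℤ // p ≠ 0}, A p.1 := by
    refine (tsum_subtype_eq_of_support_subset (f := A) (s := {p : Fin 2 → ℤ | p ≠ 0}) ?_).symm
    intro p hp
    rw [Function.mem_support] at hp
    intro h0
    apply hp
    rw [hA]
    dsimp only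
    rw [if_neg]
    exact fun h ↦ h.1 h0
  -- β : reindex by `(g, w) ↦ g • w`
  set e := Equiv.ofBijective _ bijective_smul_coprime with he
  rw [hα, ← e.tsum_eq, ENNReal.tsum_prod']
  -- γ : the summand at `g • w`
  have hγ : ∀ (g : ℕ+) (w : {w : Fin 2 → ℤ // IsCoprime (w 0) (w 1)}), A (e (g, w)).1 =
      if (t : ℤ) ∣ ((g : ℕ) : ℤ) * w.1 0 then
        ENNReal.ofReal ((z.im / Complex.normSq ((w.1 0 : ℂ) * z + w.1 1)) ^ s) *
          ENNReal.ofReal (((g : ℕ) : ℝ) ^ (-(2 * s))) else 0 := by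
    intro g w
    have hne : (((g : ℕ) : ℤ) • w.1) ≠ 0 := (e (g, w)).2
    have heval : (e (g, w)).1 = ((g : ℕ) : ℤ) • w.1 := rfl
    rw [heval, hA]
    dsimp only
    have hc0 : (((g : ℕ) : ℤ) • w.1) 0 = ((g : ℕ) : ℤ) * w.1 0 := rfl
    have hq : 0 ≤ z.im / Complex.normSq ((w.1 0 : ℂ) * z + w.1 1) :=
      div_nonneg z.im_pos.le (Complex.normSq_nonneg _)
    by_cases hdvd : (t : ℤ) ∣ ((g : ℕ) : ℤ) * w.1 0
    · rw [if_pos ⟨hne, by rw [hc0]; exact hdvd⟩, if_pos hdvd, im_div_normSq_smul,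
        Real.div_rpow hq (sq_nonneg _),
        ← ENNReal.ofReal_mul (Real.rpow_nonneg hq _)]
      congr 1
      have hg : (0 : ℝ) < ((g : ℕ) : ℤ) := by exact_mod_cast g.pos
      rw [Real.rpow_neg (by positivity), div_eq_mul_inv]
      congr 2
      rw [show ((((g : ℕ) : ℤ) : ℝ)) = ((g : ℕ) : ℝ) by norm_cast, ← Real.rpow_natCast, ← Real.rpow_mul (by positivity)]
      norm_num
    · rw [if_neg (fun h ↦ hdvd (by rw [← hc0]; exact h.2)), if_neg hdvd]
  simp_rw [hγ]
  -- δ : swap the sums and factor the `w`-part out of the inner sum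
  rw [ENNReal.tsum_comm]
  have hδ : ∀ w : {w : Fin 2 → ℤ // IsCoprime (w 0) (w 1)},
      ∑' g : ℕ+, (if (t : ℤ) ∣ ((g : ℕ) : ℤ) * w.1 0 then
        ENNReal.ofReal ((z.im / Complex.normSq ((w.1 0 : ℂ) * z + w.1 1)) ^ s) *
          ENNReal.ofReal (((g : ℕ) : ℝ) ^ (-(2 * s))) else 0) =
      ENNReal.ofReal ((z.im / Complex.normSq ((w.1 0 : ℂ) * z + w.1 1)) ^ s) *
        ∑' g : ℕ+, (if (t : ℤ) ∣ ((g : ℕ) : ℤ) * w.1 0 then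
          ENNReal.ofReal (((g : ℕ) : ℝ) ^ (-(2 * s))) else 0) := by
    intro w
    rw [← ENNReal.tsum_mul_left]
    refine tsum_congr fun g ↦ ?_
    split_ifs <;> simp
  simp_rw [hδ, tsum_pnat_ite_dvd_rpow ht _ (by linarith : 1 < 2 * s)]
  rw [← ENNReal.tsum_mul_left]
  refine tsum_congr fun w ↦ ?_
  have hq : 0 ≤ z.im / Complex.normSq ((w.1 0 : ℂ) * z + w.1 1) :=
    div_nonneg z.im_pos.le (Complex.normSq_nonneg _)
  rw [ENNReal.ofReal_mul (by positivity), ENNReal.ofReal_mul (Real.rpow_nonneg hq _)]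
  ring

/-- `(y/|p₀z+p₁|²)ˢ = 1/Q_z(p)ˢ` for every pair `p` and `s > 0` (both sides vanish at `p = 0`;
`Q_z` is the tree's `qForm`). [folklore] -/
theorem rpow_im_div_normSq_eq (z : ℍ) {s : ℝ} (hs : 0 < s) (p : Fin 2 → ℤ) :
    (z.im / Complex.normSq ((p 0 : ℂ) * z + p 1)) ^ s = 1 / qForm z p ^ s := by
  unfold qForm
  rw [Complex.normSq_eq_norm_sq]
  by_cases hp : p = 0
  · subst hp
    simp [Real.zero_rpow hs.ne']
  · have hL : 0 < ‖(p 0 : ℂ) * z + p 1‖ := norm_pos_iff.mpr (linear_ne_zero_of_ne_zero hp z)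
    have hy := z.im_pos
    rw [show z.im / ‖(p 0 : ℂ) * z + p 1‖ ^ 2 = (‖(p 0 : ℂ) * z + p 1‖ ^ 2 / z.im)⁻¹ by
      rw [inv_div], Real.inv_rpow (by positivity), one_div]

/-- `Σ_p (y/|p₀z+p₁|²)ˢ < ∞` for `s > 1` (the Epstein zeta function; the tree's
`summable_one_div_qForm_rpow`). [folklore] -/
theorem summable_rpow_im_div_normSq (z : ℍ) {s : ℝ} (hs : 1 < s) :
    Summable fun p : Fin 2 → ℤ ↦ (z.im / Complex.normSq ((p 0 : ℂ) * z + p 1)) ^ s := by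
  simp_rw [rpow_im_div_normSq_eq z (by linarith : 0 < s)]
  exact summable_one_div_qForm_rpow z hs

/-- The gcd sorting `tsum_ite_dvd_eq_tsum_coprime` as an identity of real numbers for `s > 1`
(everything is finite). [cite: Iwaniec2002, §3.2 (3.11), PDF p. 43] -/
theorem tsum_ite_dvd_eq_tsum_coprime_real (z : ℍ) {s : ℝ} (hs : 1 < s) {t : ℕ} (ht : 0 < t) :
    ∑' p : Fin 2 → ℤ, (if p ≠ 0 ∧ (t : ℤ) ∣ p 0 then
        (z.im / Complex.normSq ((p 0 : ℂ) * z + p 1)) ^ s else 0) =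
      (∑' m : ℕ+, ((m : ℕ) : ℝ) ^ (-(2 * s))) *
        ∑' w : {w : Fin 2 → ℤ // IsCoprime (w 0) (w 1)},
          (z.im / Complex.normSq ((w.1 0 : ℂ) * z + w.1 1)) ^ s *
            (((Nat.gcd t (w.1 0).natAbs : ℕ) : ℝ) / t) ^ (2 * s) := by
  classical
  have hq : ∀ p : Fin 2 → ℤ, 0 ≤ z.im / Complex.normSq ((p 0 : ℂ) * z + p 1) := fun p ↦
    div_nonneg z.im_pos.le (Complex.normSq_nonneg _)
  have hsum := summable_rpow_im_div_normSq z hs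
  -- the left-hand side family and its summability
  have hL_nonneg : ∀ p : Fin 2 → ℤ, 0 ≤ (if p ≠ 0 ∧ (t : ℤ) ∣ p 0 then
      (z.im / Complex.normSq ((p 0 : ℂ) * z + p 1)) ^ s else 0) := fun p ↦ by
    split_ifs
    · exact Real.rpow_nonneg (hq p) _
    · exact le_rfl
  have hL_sum : Summable fun p : Fin 2 → ℤ ↦ (if p ≠ 0 ∧ (t : ℤ) ∣ p 0 then
      (z.im / Complex.normSq ((p 0 : ℂ) * z + p 1)) ^ s else 0) := by
    refine Summable.of_nonneg_of_le hL_nonneg (fun p ↦ ?_) hsum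
    split_ifs
    · exact le_rfl
    · exact Real.rpow_nonneg (hq p) _
  -- the right-hand side family and its summability
  have hgt : ∀ w : {w : Fin 2 → ℤ // IsCoprime (w 0) (w 1)},
      (((Nat.gcd t (w.1 0).natAbs : ℕ) : ℝ) / t) ^ (2 * s) ≤ 1 := by
    intro w
    refine Real.rpow_le_one (by positivity) ?_ (by linarith)
    rw [div_le_one (by exact_mod_cast ht)]
    exact_mod_cast Nat.le_of_dvd ht (Nat.gcd_dvd_left _ _)
  have hR_nonneg : ∀ w : {w : Fin 2 → ℤ // IsCoprime (w 0) (w 1)},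
      0 ≤ (z.im / Complex.normSq ((w.1 0 : ℂ) * z + w.1 1)) ^ s *
        (((Nat.gcd t (w.1 0).natAbs : ℕ) : ℝ) / t) ^ (2 * s) := fun w ↦
    mul_nonneg (Real.rpow_nonneg (hq _) _) (by positivity)
  have hR_sum : Summable fun w : {w : Fin 2 → ℤ // IsCoprime (w 0) (w 1)} ↦
      (z.im / Complex.normSq ((w.1 0 : ℂ) * z + w.1 1)) ^ s *
        (((Nat.gcd t (w.1 0).natAbs : ℕ) : ℝ) / t) ^ (2 * s) := by
    refine Summable.of_nonneg_of_le hR_nonneg (fun w ↦ ?_)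
      (hsum.comp_injective Subtype.val_injective)
    simpa using mul_le_mul_of_nonneg_left (hgt w) (Real.rpow_nonneg (hq w.1) _)
  have hζ_nonneg : 0 ≤ ∑' m : ℕ+, ((m : ℕ) : ℝ) ^ (-(2 * s)) :=
    tsum_nonneg fun m ↦ Real.rpow_nonneg (by positivity) _
  -- compare in `ℝ≥0∞`
  rw [← ENNReal.ofReal_eq_ofReal_iff (tsum_nonneg hL_nonneg) (mul_nonneg hζ_nonneg (tsum_nonneg hR_nonneg)),
    ENNReal.ofReal_tsum_of_nonneg hL_nonneg hL_sum, ENNReal.ofReal_mul hζ_nonneg,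
    ENNReal.ofReal_tsum_of_nonneg hR_nonneg hR_sum]
  have h := tsum_ite_dvd_eq_tsum_coprime z (by linarith : 1 / 2 < s) ht
  refine Eq.trans (tsum_congr fun p ↦ ?_) h
  by_cases hp : p ≠ 0 ∧ (t : ℤ) ∣ p 0
  · rw [if_pos hp, if_pos hp]
  · rw [if_neg hp, if_neg hp, ENNReal.ofReal_zero]

/-- The divisors of `gcd(t, m)` are the divisors of `t` dividing `m` (`t ≥ 1`). [folklore] -/
theorem divisors_gcd_eq_filter {t : ℕ} (ht : 0 < t) (m : ℕ) :
    (Nat.gcd t m).divisors = t.divisors.filter (· ∣ m) := by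
  ext u
  simp only [Nat.mem_divisors, Finset.mem_filter, Nat.dvd_gcd_iff, ne_eq, Nat.gcd_eq_zero_iff, ht.ne',
    false_and, not_false_eq_true, and_true]

open ArithmeticFunction in
/-- **The Möbius step**: with `J_s(u) = Σ_{de=u} μ(d) e^{2s}` (so `Σ_{u ∣ n} J_s(u) = n^{2s}`, Mathlib
`ArithmeticFunction.sum_eq_iff_sum_smul_moebius_eq`),
`Σ_{w coprime} (y/|w₀z+w₁|²)ˢ (gcd(t,|w₀|)/t)^{2s} = t^{-2s} Σ_{u ∣ t} J_s(u) G_u(z, s)`,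
`G_u(z, s) = Σ_{(c,d)=1, u ∣ c} (y/|cz+d|²)ˢ` (`s > 1`). (Diamond–Shurman §4.2 / Iwaniec §3.2: the
level-`N` Eisenstein series from level one by Möbius inversion.) [folklore] -/
theorem tsum_coprime_gcd_rpow_eq_sum_divisors (z : ℍ) {s : ℝ} (hs : 1 < s) {t : ℕ} (ht : 0 < t) :
    ∑' w : {w : Fin 2 → ℤ // IsCoprime (w 0) (w 1)},
        (z.im / Complex.normSq ((w.1 0 : ℂ) * z + w.1 1)) ^ s *
          (((Nat.gcd t (w.1 0).natAbs : ℕ) : ℝ) / t) ^ (2 * s) =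
      (t : ℝ) ^ (-(2 * s)) * ∑ u ∈ t.divisors,
        (∑ x ∈ u.divisorsAntidiagonal, (moebius x.1 : ℝ) * (x.2 : ℝ) ^ (2 * s)) *
          ∑' v : {v : Fin 2 → ℤ // IsCoprime (v 0) (v 1) ∧ (u : ℤ) ∣ v 0},
            (z.im / Complex.normSq ((v.1 0 : ℂ) * z + v.1 1)) ^ s := by
  classical
  set J : ℕ → ℝ := fun u ↦ ∑ x ∈ u.divisorsAntidiagonal, (moebius x.1 : ℝ) * (x.2 : ℝ) ^ (2 * s)
    with hJdef
  have hJ : ∀ n : ℕ, 0 < n → ∑ i ∈ n.divisors, J i = ((n : ℕ) : ℝ) ^ (2 * s) :=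
    (sum_eq_iff_sum_smul_moebius_eq (f := J) (g := fun n : ℕ ↦ ((n : ℕ) : ℝ) ^ (2 * s))).mpr
      (fun n _ ↦ by simp [hJdef, zsmul_eq_mul])
  have hq : ∀ p : Fin 2 → ℤ, 0 ≤ z.im / Complex.normSq ((p 0 : ℂ) * z + p 1) := fun p ↦
    div_nonneg z.im_pos.le (Complex.normSq_nonneg _)
  have hsum := summable_rpow_im_div_normSq z hs
  have hsumC : Summable fun w : {w : Fin 2 → ℤ // IsCoprime (w 0) (w 1)} ↦
      (z.im / Complex.normSq ((w.1 0 : ℂ) * z + w.1 1)) ^ s :=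
    hsum.comp_injective Subtype.val_injective
  -- `gcd(t, |c|)^{2s} = Σ_{u ∣ t, u ∣ c} J(u)`
  have hgcd : ∀ w : {w : Fin 2 → ℤ // IsCoprime (w 0) (w 1)},
      (((Nat.gcd t (w.1 0).natAbs : ℕ) : ℝ) / t) ^ (2 * s) =
        (t : ℝ) ^ (-(2 * s)) * ∑ u ∈ t.divisors, if u ∣ (w.1 0).natAbs then J u else 0 := by
    intro w
    rw [← Finset.sum_filter, ← divisors_gcd_eq_filter ht, hJ _ (Nat.gcd_pos_of_pos_left _ ht),
      Real.div_rpow (by positivity) (by positivity), Real.rpow_neg (by positivity), div_eq_inv_mul]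
  simp_rw [hgcd]
  -- bring the finite sum outside
  have hstep : ∀ w : {w : Fin 2 → ℤ // IsCoprime (w 0) (w 1)},
      (z.im / Complex.normSq ((w.1 0 : ℂ) * z + w.1 1)) ^ s *
        ((t : ℝ) ^ (-(2 * s)) * ∑ u ∈ t.divisors, if u ∣ (w.1 0).natAbs then J u else 0) =
      ∑ u ∈ t.divisors, (t : ℝ) ^ (-(2 * s)) * J u *
        (if u ∣ (w.1 0).natAbs then (z.im / Complex.normSq ((w.1 0 : ℂ) * z + w.1 1)) ^ s else 0) := by
    intro w
    rw [Finset.mul_sum, Finset.mul_sum]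
    refine Finset.sum_congr rfl fun u _ ↦ ?_
    split_ifs <;> ring
  simp_rw [hstep]
  rw [Summable.tsum_finsetSum (fun u _ ↦ ?_)]
  · rw [Finset.mul_sum]
    refine Finset.sum_congr rfl fun u hu ↦ ?_
    -- the two indexations of `G_u`
    have e1 : ∑' w : {w : Fin 2 → ℤ // IsCoprime (w 0) (w 1)},
        (if u ∣ (w.1 0).natAbs then (z.im / Complex.normSq ((w.1 0 : ℂ) * z + w.1 1)) ^ s else 0) =
        ∑' p : Fin 2 → ℤ, Set.indicator {w : Fin 2 → ℤ | IsCoprime (w 0) (w 1)}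
          (fun p ↦ if u ∣ (p 0).natAbs then (z.im / Complex.normSq ((p 0 : ℂ) * z + p 1)) ^ s else 0) p :=
      tsum_subtype {w : Fin 2 → ℤ | IsCoprime (w 0) (w 1)}
        (fun p ↦ if u ∣ (p 0).natAbs then (z.im / Complex.normSq ((p 0 : ℂ) * z + p 1)) ^ s else 0)
    have e2 : ∑' v : {v : Fin 2 → ℤ // IsCoprime (v 0) (v 1) ∧ (u : ℤ) ∣ v 0},
        (z.im / Complex.normSq ((v.1 0 : ℂ) * z + v.1 1)) ^ s =
        ∑' p : Fin 2 → ℤ, Set.indicator {v : Fin 2 → ℤ | IsCoprime (v 0) (v 1) ∧ (u : ℤ) ∣ v 0}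
          (fun p ↦ (z.im / Complex.normSq ((p 0 : ℂ) * z + p 1)) ^ s) p :=
      tsum_subtype {v : Fin 2 → ℤ | IsCoprime (v 0) (v 1) ∧ (u : ℤ) ∣ v 0}
        (fun p ↦ (z.im / Complex.normSq ((p 0 : ℂ) * z + p 1)) ^ s)
    have e3 : ∑' w : {w : Fin 2 → ℤ // IsCoprime (w 0) (w 1)},
        (if u ∣ (w.1 0).natAbs then (z.im / Complex.normSq ((w.1 0 : ℂ) * z + w.1 1)) ^ s else 0) =
        ∑' v : {v : Fin 2 → ℤ // IsCoprime (v 0) (v 1) ∧ (u : ℤ) ∣ v 0},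
          (z.im / Complex.normSq ((v.1 0 : ℂ) * z + v.1 1)) ^ s := by
      rw [e1, e2]
      refine tsum_congr fun (p : Fin 2 → ℤ) ↦ ?_
      by_cases h1 : IsCoprime (p 0) (p 1)
      · by_cases h2 : u ∣ (p 0).natAbs
        · rw [Set.indicator_of_mem (show p ∈ {w : Fin 2 → ℤ | IsCoprime (w 0) (w 1)} from h1),
            Set.indicator_of_mem (show p ∈ {v : Fin 2 → ℤ | IsCoprime (v 0) (v 1) ∧ (u : ℤ) ∣ v 0} from
              ⟨h1, Int.natCast_dvd.mpr h2⟩), if_pos h2]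
        · rw [Set.indicator_of_mem (show p ∈ {w : Fin 2 → ℤ | IsCoprime (w 0) (w 1)} from h1),
            Set.indicator_of_notMem (show p ∉ {v : Fin 2 → ℤ | IsCoprime (v 0) (v 1) ∧ (u : ℤ) ∣ v 0} from
              fun h ↦ h2 (Int.natCast_dvd.mp h.2)), if_neg h2]
      · rw [Set.indicator_of_notMem (show p ∉ {w : Fin 2 → ℤ | IsCoprime (w 0) (w 1)} from h1),
          Set.indicator_of_notMem (show p ∉ {v : Fin 2 → ℤ | IsCoprime (v 0) (v 1) ∧ (u : ℤ) ∣ v 0} from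
            fun h ↦ h1 h.1)]
    rw [tsum_mul_left, mul_assoc, e3]
  · have hb : Summable fun w : {w : Fin 2 → ℤ // IsCoprime (w 0) (w 1)} ↦
        |(t : ℝ) ^ (-(2 * s)) * J u| * (z.im / Complex.normSq ((w.1 0 : ℂ) * z + w.1 1)) ^ s :=
      hsumC.mul_left _
    refine Summable.of_norm_bounded hb fun w ↦ ?_
    rw [Real.norm_eq_abs, abs_mul]
    refine mul_le_mul_of_nonneg_left ?_ (abs_nonneg _)
    split_ifs
    · rw [abs_of_nonneg (Real.rpow_nonneg (hq _) _)]
    · rw [abs_zero]; exact Real.rpow_nonneg (hq _) _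

end GcdSorting

/-! ### The substitution `p₀ = tm` -/

section Scaling

/-- `y/|(tm)z + n|² = (Im(tz)/|m(tz) + n|²)/t` for the scaled point `tz ∈ ℍ` (Mathlib
`UpperHalfPlane.posRealAction`). [folklore] -/
theorem im_div_normSq_scaled (z : ℍ) {t : ℕ} (ht : 0 < t) (p : Fin 2 → ℤ) :
    z.im / Complex.normSq ((((t : ℤ) * p 0 : ℤ) : ℂ) * z + p 1) =
      ((⟨t, by exact_mod_cast ht⟩ : {x : ℝ // 0 < x}) • z).im /
        Complex.normSq ((p 0 : ℂ) * ((⟨t, by exact_mod_cast ht⟩ : {x : ℝ // 0 < x}) • z : ℍ) + p 1) / t := by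
  rw [UpperHalfPlane.pos_real_im, UpperHalfPlane.coe_pos_real_smul]
  simp only [Int.cast_mul, Int.cast_natCast, Complex.real_smul, Complex.ofReal_natCast]
  rw [show (p 0 : ℂ) * ((t : ℂ) * (z : ℂ)) + p 1 = (t : ℂ) * (p 0 : ℂ) * z + p 1 by ring]
  have htr : (t : ℝ) ≠ 0 := by exact_mod_cast ht.ne'
  field_simp

/-- **The substitution `p₀ = tm`**: `Σ_{p ≠ 0, t ∣ p₀} (y/|p₀z+p₁|²)ˢ = t^{-s} Σ_{p ≠ 0}
(Im(tz)/|p₀(tz) + p₁|²)ˢ` (the map `(m, n) ↦ (tm, n)` is a bijection onto the support). [folklore] -/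
theorem tsum_ite_dvd_eq_rpow_mul_tsum_scaled (z : ℍ) (s : ℝ) {t : ℕ} (ht : 0 < t) :
    ∑' p : Fin 2 → ℤ, (if p ≠ 0 ∧ (t : ℤ) ∣ p 0 then
        (z.im / Complex.normSq ((p 0 : ℂ) * z + p 1)) ^ s else 0) =
      (t : ℝ) ^ (-s) * ∑' p : Fin 2 → ℤ, (if p ≠ 0 ∧ ((1 : ℕ) : ℤ) ∣ p 0 then
        (((⟨t, by exact_mod_cast ht⟩ : {x : ℝ // 0 < x}) • z).im /
          Complex.normSq ((p 0 : ℂ) * ((⟨t, by exact_mod_cast ht⟩ : {x : ℝ // 0 < x}) • z : ℍ) + p 1)) ^ s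
        else 0) := by
  set ι : (Fin 2 → ℤ) → (Fin 2 → ℤ) := fun p ↦ ![(t : ℤ) * p 0, p 1] with hι
  have htz : (t : ℤ) ≠ 0 := by exact_mod_cast ht.ne'
  have hinj : Function.Injective ι := by
    intro p q h
    have h0 : (t : ℤ) * p 0 = (t : ℤ) * q 0 := by
      have := congrFun h 0; simpa [hι] using this
    have h1 : p 1 = q 1 := by
      have := congrFun h 1; simpa [hι] using this
    funext i
    fin_cases i
    · exact mul_left_cancel₀ htz h0
    · exact h1
  have hsupp : Function.support (fun p : Fin 2 → ℤ ↦ (if p ≠ 0 ∧ (t : ℤ) ∣ p 0 then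
      (z.im / Complex.normSq ((p 0 : ℂ) * z + p 1)) ^ s else 0)) ⊆ Set.range ι := by
    intro p hp
    rw [Function.mem_support] at hp
    have hc : p ≠ 0 ∧ (t : ℤ) ∣ p 0 := by
      by_contra h
      exact hp (if_neg h)
    obtain ⟨m, hm⟩ := hc.2
    refine ⟨![m, p 1], ?_⟩
    funext i
    fin_cases i
    · simp [hι, hm]
    · simp [hι]
  rw [← hinj.tsum_eq hsupp, ← tsum_mul_left]
  refine tsum_congr fun p ↦ ?_
  have hιp0 : (ι p) 0 = (t : ℤ) * p 0 := by simp [hι]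
  have hιp1 : (ι p) 1 = p 1 := by simp [hι]
  have hne : (ι p ≠ 0) ↔ p ≠ 0 := by
    constructor
    · intro h hp
      apply h
      funext i
      fin_cases i
      · simp [hι, hp]
      · simp [hι, hp]
    · intro h hιp
      apply h
      funext i
      fin_cases i
      · have := congrFun hιp 0
        simp only [hι, Matrix.cons_val_zero, Pi.zero_apply, mul_eq_zero, htz, false_or] at this
        simpa using this
      · have := congrFun hιp 1
        simpa [hι] using this
  by_cases hp : p ≠ 0
  · rw [if_pos ⟨hne.mpr hp, by rw [hιp0]; exact dvd_mul_right _ _⟩, if_pos ⟨hp, one_dvd _⟩, hιp0, hιp1,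
      im_div_normSq_scaled z ht p, Real.div_rpow ?_ (by positivity), Real.rpow_neg (by positivity),
      div_eq_inv_mul]
    exact div_nonneg (UpperHalfPlane.im_pos _).le (Complex.normSq_nonneg _)
  · rw [if_neg (fun h ↦ hp (hne.mp h.1)), if_neg (fun h ↦ hp h.1), mul_zero]

end Scaling

/-! ### The identity `Σ_{u ∣ t} J_s(u) G_u(z, s) = tˢ G₁(tz, s)` -/

section HeckeIdentity

open ArithmeticFunction

/-- `Σ_{m≥1} m^{-2s} > 0` (`2s > 1`). [folklore] -/
theorem tsum_pnat_rpow_neg_pos {s : ℝ} (hs : 1 < 2 * s) : 0 < ∑' m : ℕ+, ((m : ℕ) : ℝ) ^ (-(2 * s)) :=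
  (summable_pnat_rpow_neg hs).tsum_pos (fun m ↦ Real.rpow_nonneg (by positivity) _) 1 (by simp)

/-- **The Hecke-type identity for the Eisenstein series of the cusp `∞` of `Γ₀(t)`**: for `t ≥ 1`,
real `s > 1` and `z ∈ ℍ`,
`Σ_{u ∣ t} J_s(u) · G_u(z, s) = tˢ · G₁(tz, s)`, where `G_u(z, s) = Σ_{(c,d)=1, u ∣ c} (y/|cz+d|²)ˢ`
(`= 2E_∞^{Γ₀(u)}(z, s)`), `G₁ = 2E` (level one), `J_s(u) = Σ_{de=u} μ(d)e^{2s}` and `tz` is the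
scaled point: compute `Σ_{p ≠ 0, t ∣ p₀}(y/|p₀z+p₁|²)ˢ` by gcd sorting + Möbius
(`= ζ⁺(2s) t^{-2s} Σ_{u∣t} J_s(u) G_u(z,s)`) and by the substitution `p₀ = tm`
(`= t^{-s} ζ⁺(2s) G₁(tz, s)`), and cancel `ζ⁺(2s) > 0`. Equivalent to the classical expression of
`E_∞^{Γ₀(N)}(z, s)` as a combination of `E(dz, s)`, `d ∣ N` (Diamond–Shurman §4.2; Iwaniec §3.2,
§13 for `Γ₀(N)`). [cite: DiamondShurman2005, §4.2 (Eisenstein series of level N from level one via Möbius inversion)] -/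
theorem sum_divisors_moebius_mul_tsum_coprime_eq (z : ℍ) {s : ℝ} (hs : 1 < s) {t : ℕ} (ht : 0 < t) :
    ∑ u ∈ t.divisors, (∑ x ∈ u.divisorsAntidiagonal, (moebius x.1 : ℝ) * (x.2 : ℝ) ^ (2 * s)) *
        ∑' v : {v : Fin 2 → ℤ // IsCoprime (v 0) (v 1) ∧ (u : ℤ) ∣ v 0},
          (z.im / Complex.normSq ((v.1 0 : ℂ) * z + v.1 1)) ^ s =
      (t : ℝ) ^ s * ∑' v : {v : Fin 2 → ℤ // IsCoprime (v 0) (v 1) ∧ ((1 : ℕ) : ℤ) ∣ v 0},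
        (((⟨t, by exact_mod_cast ht⟩ : {x : ℝ // 0 < x}) • z).im /
          Complex.normSq ((v.1 0 : ℂ) * ((⟨t, by exact_mod_cast ht⟩ : {x : ℝ // 0 < x}) • z : ℍ) + v.1 1)) ^ s := by
  set tz : ℍ := (⟨t, by exact_mod_cast ht⟩ : {x : ℝ // 0 < x}) • z with htz
  have hζ := tsum_pnat_rpow_neg_pos (by linarith : 1 < 2 * s)
  have hA := tsum_ite_dvd_eq_tsum_coprime_real z hs ht
  have hB := tsum_coprime_gcd_rpow_eq_sum_divisors z hs ht
  have hA1 := tsum_ite_dvd_eq_tsum_coprime_real tz hs (t := 1) one_pos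
  have hB1 := tsum_coprime_gcd_rpow_eq_sum_divisors tz hs (t := 1) one_pos
  have hC := tsum_ite_dvd_eq_rpow_mul_tsum_scaled z s ht
  rw [hB] at hA
  rw [hB1] at hA1
  simp only [Nat.divisors_one, Finset.sum_singleton, Nat.divisorsAntidiagonal_one, moebius_apply_one,
    Int.cast_one, Nat.cast_one, Real.one_rpow, one_mul] at hA1
  rw [hA] at hC
  rw [← htz] at hC
  simp only [Nat.cast_one] at hC
  rw [hA1] at hC
  -- hC : ζ⁺ * (t^{-2s} * Σ) = t^{-s} * (ζ⁺ * G₁(tz))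
  have hts : (0 : ℝ) < t := by exact_mod_cast ht
  have key : (t : ℝ) ^ (-(2 * s)) * (∑ u ∈ t.divisors,
      (∑ x ∈ u.divisorsAntidiagonal, (moebius x.1 : ℝ) * (x.2 : ℝ) ^ (2 * s)) *
        ∑' v : {v : Fin 2 → ℤ // IsCoprime (v 0) (v 1) ∧ (u : ℤ) ∣ v 0},
          (z.im / Complex.normSq ((v.1 0 : ℂ) * z + v.1 1)) ^ s) =
      (t : ℝ) ^ (-s) * ∑' v : {v : Fin 2 → ℤ // IsCoprime (v 0) (v 1) ∧ ((1 : ℕ) : ℤ) ∣ v 0},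
        (tz.im / Complex.normSq ((v.1 0 : ℂ) * tz + v.1 1)) ^ s := by
    apply mul_left_cancel₀ hζ.ne'
    rw [hC]
    ring
  have h2 : (t : ℝ) ^ (2 * s) * ((t : ℝ) ^ (-(2 * s))) = 1 := by
    rw [Real.rpow_neg hts.le, mul_inv_cancel₀ (Real.rpow_pos_of_pos hts _).ne']
  have h3 : (t : ℝ) ^ (2 * s) * (t : ℝ) ^ (-s) = (t : ℝ) ^ s := by
    rw [← Real.rpow_add hts]; ring_nf
  calc _ = (t : ℝ) ^ (2 * s) * ((t : ℝ) ^ (-(2 * s)) * (∑ u ∈ t.divisors,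
      (∑ x ∈ u.divisorsAntidiagonal, (moebius x.1 : ℝ) * (x.2 : ℝ) ^ (2 * s)) *
        ∑' v : {v : Fin 2 → ℤ // IsCoprime (v 0) (v 1) ∧ (u : ℤ) ∣ v 0},
          (z.im / Complex.normSq ((v.1 0 : ℂ) * z + v.1 1)) ^ s)) := by
          rw [← mul_assoc, h2, one_mul]
    _ = (t : ℝ) ^ (2 * s) * ((t : ℝ) ^ (-s) * ∑' v : {v : Fin 2 → ℤ // IsCoprime (v 0) (v 1) ∧ ((1 : ℕ) : ℤ) ∣ v 0},
        (tz.im / Complex.normSq ((v.1 0 : ℂ) * tz + v.1 1)) ^ s) := by rw [key]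
    _ = _ := by rw [← mul_assoc, h3]

end HeckeIdentity


end Literature.NumberTheory.EllipticCurves.ModularForms

end
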